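import Literature.IUT.HodgeTheaters.GlobalFrobenioidsModel
import HarnessLib

/-!
# [IUTchI] Example 5.1 (iii): the identification `Base(†ℱ^⊛) ⥲ †𝒟^⊛` is UNIQUELY determined —
# the printed justification as an intermediate statement, and the uniqueness it yields

Mochizuki, *Inter-universal Teichmüller theory I*, §5, Example 5.1 (iii), kurims manuscript (May 2020)
p. 125 ([IUTchI] Ex 5.1 (iii) p.125) [claim: Mochizuki2012, status: disputed]: "Suppose further that we
have been given a morphism `†𝒟^⊚ → Base(†ℱ^⊛)` which is abstractly equivalent [cf. §0] to the natural
morphism `†𝒟^⊚ → †𝒟^⊛` [cf. (i)].  In the following discussion, we shall use the resulting [uniquely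
determined, in light of the `F`-coricity of `C_F`, together with [AbsTopIII], Theorem 1.9!] isomorphism
`Base(†ℱ^⊛) ⥲ †𝒟^⊛` to identify `Base(†ℱ^⊛)` with `†𝒟^⊛`."

Sub-DAG statements file (row E51/L11 of SUBDAG-IUTchI-Ex51; director-frontier 2026-08-25T23:59:05Z
queue (1); nodes = IUTchI:Ex5.1(iii)).  abc-iut-L5-t1's `GlobalFrobenioid` (`GlobalFrobenioidsModel.lean`)
records the identification `identify : Base ≌ †𝒟^⊛` (with the witnesses `α₁`, `compat` of abstract
equivalence) as DATA; the bracketed UNIQUENESS claim was not typed.  Here: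

* `BaseCatRigid G` — the INTERMEDIATE STATEMENT the bracket appeals to, for `G = π₁(†𝒟^⊛)`: every
  self-equivalence of `†𝒟^⊛ = ℬ(G)⁰` is isomorphic to the identity [self-equivalences of the connected
  Galois category `ℬ(Π)⁰` ↔ outer automorphisms of `Π`; for `Π = π₁(C_{F_mod})` these come from
  automorphisms of `C_{F_mod}` ([AbsTopIII] Thm 1.9) and are trivial by the `F`-coricity of `C_F`
  (Def. 3.1 (b); Rmk 3.1.2)].  A predicate on `G` — an [IUTchI]-internal step to be PROVED at the L4/L5
  merge (it is FALSE for a general profinite `G`), NOT a Literature fact and not asserted;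
* `GlobalFrobenioid.identify_unique` — PROVED: under `BaseCatRigid G`, ANY identification
  `Base(†ℱ^⊛) ≌ †𝒟^⊛` is isomorphic (as a functor) to the recorded one; pure category theory
  (`Equivalence.nonempty_functor_iso_of_rigid`), no compatibility datum is even needed.

typed ≠ proved; no new Literature fact; no side taken on [IUTchIII] Cor. 3.12.
-/

namespace Literature.IUT.HodgeTheaters

open CategoryTheory

universe v' u' u

/-! ### Rigidity of a category: every self-equivalence is isomorphic to the identity -/

/-- If every self-equivalence of `D` is isomorphic to the identity functor, then any two equivalences
`C ≌ D` have isomorphic functors (`I' ≅ 𝟭 ⋙ I' ≅ (I ⋙ I⁻¹) ⋙ I' ≅ I ⋙ (I⁻¹ ⋙ I') ≅ I ⋙ 𝟭 ≅ I`).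
Pure category theory. ([IUTchI] Ex 5.1 (iii) p.125) [claim: Mochizuki2012, status: disputed] -/
theorem Equivalence.nonempty_functor_iso_of_rigid {C : Type u'} [Category.{v'} C] {D : Type u}
    [Category.{v'} D] (h : ∀ Φ : D ≌ D, Nonempty (Φ.functor ≅ 𝟭 D)) (I I' : C ≌ D) :
    Nonempty (I'.functor ≅ I.functor) := by
  obtain ⟨e⟩ := h (I.symm.trans I')
  -- `(I.symm.trans I').functor = I.inverse ⋙ I'.functor` definitionally
  have e' : I.inverse ⋙ I'.functor ≅ 𝟭 D := e
  exact ⟨I'.functor.leftUnitor.symm ≪≫ Functor.isoWhiskerRight I.unitIso I'.functor ≪≫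
    Functor.associator I.functor I.inverse I'.functor ≪≫ Functor.isoWhiskerLeft I.functor e' ≪≫
    I.functor.rightUnitor⟩

/-! ### The intermediate statement and the uniqueness of the identification -/

/-- **Ex. 5.1 (iii), p. 125, the bracket "uniquely determined, in light of the `F`-coricity of `C_F`,
together with [AbsTopIII], Theorem 1.9"** as an intermediate statement on `G = π₁(†𝒟^⊛)`: every
self-equivalence of `†𝒟^⊛ = ℬ(G)⁰` is isomorphic to the identity.  [Mechanism, for the record:
self-equivalences of the connected Galois category `ℬ(Π)⁰` correspond to outer automorphisms of `Π`;
for `Π = π₁(C_{F_mod})` an automorphism of `Π` arises from an automorphism of the orbicurve `C_{F_mod}`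
([AbsTopIII] Thm 1.9), and `C_F` being an `F`-core (Def. 3.1 (b), Rmk 3.1.2) such automorphisms are
trivial.]  A predicate — to be PROVED at the L4/L5 merge for the genuine `π₁(†𝒟^⊛)`; false for a
general profinite group; NOT a fact, not asserted. ([IUTchI] Ex 5.1 (iii) p.125)
[claim: Mochizuki2012, status: disputed] -/
@[mk_iff] structure BaseCatRigid (G : ProfiniteGrp.{u}) : Prop where
  /-- every self-equivalence of `ℬ(G)⁰` is isomorphic to the identity functor -/
  iso_id : ∀ Φ : BaseCat G ≌ BaseCat G, Nonempty (Φ.functor ≅ 𝟭 (BaseCat G))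

namespace GlobalFrobenioid

variable {G : ProfiniteGrp.{u}} {Δ : GlobalDivisorData G} {Dcirc : Type (u + 1)}
  [Category.{u} Dcirc] {toBase0 : Dcirc ⥤ BaseCat G} (F : GlobalFrobenioid Δ Dcirc toBase0)

/-- **Ex. 5.1 (iii), p. 125 — the identification `Base(†ℱ^⊛) ⥲ †𝒟^⊛` is uniquely determined**: under
`BaseCatRigid π₁(†𝒟^⊛)`, any equivalence `Base(†ℱ^⊛) ≌ †𝒟^⊛` whatsoever is isomorphic, as a functor,
to the recorded `identify` (so nothing downstream depends on the choice).  PROVED from the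
intermediate statement; no compatibility with `†𝒟^⊚ → Base(†ℱ^⊛)` is needed for this.
([IUTchI] Ex 5.1 (iii) p.125) [claim: Mochizuki2012, status: disputed] -/
theorem identify_unique (h : BaseCatRigid G) (I' : F.Base ≌ BaseCat G) :
    Nonempty (I'.functor ≅ F.identify.functor) :=
  Equivalence.nonempty_functor_iso_of_rigid h.iso_id F.identify I'

/-- Object-level form: under `BaseCatRigid π₁(†𝒟^⊛)`, any two identifications send each object `A` of
`Base(†ℱ^⊛)` to isomorphic objects of `†𝒟^⊛` — in particular "lies over a terminal object of `†𝒟^⊛`"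
(the definition of `†ℱ^⊛_mod`, p. 126) does not depend on the identification.  PROVED.
([IUTchI] Ex 5.1 (iii) p.126) [claim: Mochizuki2012, status: disputed] -/
theorem overTerminal_indep (h : BaseCatRigid G) (I' : F.Base ≌ BaseCat G) (A : F.cat) :
    Nonempty (Limits.IsTerminal (I'.functor.obj (F.toBase.obj A))) ↔ F.overTerminal A := by
  obtain ⟨e⟩ := F.identify_unique h I'
  constructor
  · rintro ⟨t⟩
    exact ⟨t.ofIso (e.app (F.toBase.obj A))⟩
  · rintro ⟨t⟩
    exact ⟨t.ofIso (e.app (F.toBase.obj A)).symm⟩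

end GlobalFrobenioid

end Literature.IUT.HodgeTheaters
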